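import Summits.RiemannHypothesis.RiemannHypothesis.Theorems.Splittings.ScrewGradedFloorDictionary

/-!
# Sparse screw detection below the square-root scale (and graded above it)

RH-free LANDAU-TYPE DETECTION along SPARSE sets of integer nodes for Suzuki's screw function
`Ψ = Literature.NumberTheory.LFunctions.zetaScrew` (Suzuki2023 (1.1)).  A set `A ⊆ ℕ` is
`(C, θ)`-dense if every `m ≥ 1` has some `a ∈ A` with `m ≤ a ≤ m + C·m^θ`.

* `rise_le`        : UNCONDITIONAL one-sided rise bound `Ψ(t) − Ψ(t₀) ≤ 2 e^{t/2}(t − t₀) + C_H/4`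
                     for `0 ≤ t₀ ≤ t` (`C_H = ∑ (k+1/4)^{-2}`): the prime sum is non-decreasing, the linear
                     term has a non-negative slope constant, the Hurwitz–Lerch term is bounded, and
                     `e^{t/2} − e^{t₀/2} ≤ e^{t/2}(t − t₀)/2`.
* `denseHits`      : a `(C, θ)`-dense set, `θ < 1`, has a node `log a` in every window
                     `[t, t + (1+|C|)·e^{-(1-θ⁺)t}]`, `t ≥ 0` (`θ⁺ = max θ 0`); `stub_denseHits` is VERBATIM
                     the registered stub S3 of line `power-sparse-detect` (crux stmt-RiemannHypothesis-15757).
* `floor_of_sparsePos` : `Ψ(log a) ≥ 0` on a `(C, θ)`-dense `A` ⟹ `Ψ(t) ≥ −K·e^{max(θ−1/2,0)·t}` on `[0,∞)`.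
* `quasiRH_of_sparsePos` : … ⟹ `QuasiRiemannHypothesis (1/2 + max (θ − 1/2) 0)` (graded floor
                     dictionary `ScrewGradedFloor.quasiRH_iff_exp_floor`).
* `rh_of_sparsePos` : for `θ ≤ 1/2`, … ⟹ RH.  Hence `sqrtSparseDetect` = the statement
                     `Theses.SparseScrew.SqrtSparseDetect` (`∀ C, Rung C (1/2)`) and `rung_of_le_half`
                     (`θ ≤ 1/2 → Rung C θ`) of the line file, both THEOREMS, RH-free: positivity of `Ψ` at the
                     logarithms of ANY set of integers with gaps `O(√m)` already implies RH (the tree's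
                     `DiscreteLandau` is `A = ℕ≥1`, gaps `1`).
* `quasiRH_of_sparsePos_of_half_le` : for `1/2 ≤ θ < 1`, … ⟹ quasi-RH(θ) (all zeros in `Re s ≤ θ`).
* `rh_iff_nonneg_at_squares` : RH ⟺ `Ψ(2 log k) ≥ 0` for all `k ≥ 1` (the squares are `(3, 1/2)`-dense).

Mechanism: between two consecutive hits the window has log-length `≲ (1+|C|) e^{-(1-θ)t}` while `Ψ` rises
at rate `≤ 2e^{t/2}`, so `Ψ ≥ −O(e^{(θ−1/2)t})` everywhere; Landau (graded, `gradedLandau`) does the rest.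
Nothing in this file is a claim about the truth of RH.  Zero `def`s; axioms standard.
-/

noncomputable section

set_option linter.dupNamespace false

namespace Summit.RiemannHypothesis.RiemannHypothesis.Theorems.Splittings.ScrewSparseDetect

open Literature.NumberTheory.LFunctions
open Summit.RiemannHypothesis.RiemannHypothesis.Theorems.Splittings.ScrewGradedFloor

/-! ## 1. The unconditional one-sided rise bound -/

/-- The prime sum `φ(t) = ∑_{n ≤ e^t} Λ(n) n^{-1/2}(t − log n)` is non-decreasing on `[0, ∞)`. -/
theorem zetaScrewPrimeSum_mono {t₀ t : ℝ} (ht₀ : 0 ≤ t₀) (h : t₀ ≤ t) :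
    zetaScrewPrimeSum t₀ ≤ zetaScrewPrimeSum t := by
  have ht : 0 ≤ t := ht₀.trans h
  have hM : Real.exp |t| ≤ (⌈Real.exp t⌉₊ : ℕ) := by
    rw [abs_of_nonneg ht]; exact Nat.le_ceil _
  have hM₀ : Real.exp |t₀| ≤ (⌈Real.exp t⌉₊ : ℕ) := by
    rw [abs_of_nonneg ht₀]
    exact ((Real.exp_le_exp.2 h).trans (Nat.le_ceil _))
  rw [zetaScrewPrimeSum_eq_sum_max hM, zetaScrewPrimeSum_eq_sum_max hM₀]
  refine Finset.sum_le_sum fun n _ ↦ ?_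
  refine mul_le_mul_of_nonneg_left ?_
    (div_nonneg ArithmeticFunction.vonMangoldt_nonneg (Real.sqrt_nonneg _))
  rw [abs_of_nonneg ht₀, abs_of_nonneg ht]
  exact max_le_max (by linarith) le_rfl

/-- `e^{b} − e^{a} ≤ e^{b}(b − a)` (convexity: `1 + (a − b) ≤ e^{a−b}`). -/
private theorem exp_sub_exp_le (a b : ℝ) : Real.exp b - Real.exp a ≤ Real.exp b * (b - a) := by
  have h := Real.add_one_le_exp (a - b)
  have hb := Real.exp_pos b
  have : Real.exp a = Real.exp b * Real.exp (a - b) := by rw [← Real.exp_add]; ring_nf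
  nlinarith [this, mul_le_mul_of_nonneg_left h hb.le]

/-- **UNCONDITIONAL ONE-SIDED RISE BOUND.**  For `0 ≤ t₀ ≤ t`:
`Ψ(t) − Ψ(t₀) ≤ 2 e^{t/2}(t − t₀) + C_H/4`, `C_H = ∑_{k ≥ 0} (k + 1/4)^{-2}`. -/
theorem rise_le {t₀ t : ℝ} (ht₀ : 0 ≤ t₀) (h : t₀ ≤ t) :
    zetaScrew t - zetaScrew t₀ ≤
      2 * Real.exp (t / 2) * (t - t₀) + (1 / 4) * ∑' k : ℕ, 1 / ((k : ℝ) + 1 / 4) ^ 2 := by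
  have ht : 0 ≤ t := ht₀.trans h
  rw [zetaScrew_eq t, zetaScrew_eq t₀, abs_of_nonneg ht, abs_of_nonneg ht₀]
  set c₀ : ℝ := Real.eulerMascheroniConstant + Real.pi / 2 + 3 * Real.log 2 + Real.log Real.pi
  set CH : ℝ := ∑' k : ℕ, 1 / ((k : ℝ) + 1 / 4) ^ 2
  -- the four parts
  have hφ : zetaScrewPrimeSum t₀ ≤ zetaScrewPrimeSum t := zetaScrewPrimeSum_mono ht₀ h
  have hc₀ : 0 ≤ c₀ := by
    have h1 := Real.one_half_lt_eulerMascheroniConstant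
    have h2 : 0 ≤ Real.log 2 := Real.log_nonneg (by norm_num)
    have h3 : 0 ≤ Real.log Real.pi := Real.log_nonneg (by linarith [Real.pi_gt_three])
    have h4 := Real.pi_pos
    simp only [c₀]; linarith
  have hlin : -(t / 2 * c₀) + t₀ / 2 * c₀ ≤ 0 := by nlinarith
  have hA1 : Real.exp (t / 2) - Real.exp (t₀ / 2) ≤ Real.exp (t / 2) * (t / 2 - t₀ / 2) :=
    exp_sub_exp_le _ _
  have hA2 : Real.exp (-(t / 2)) ≤ Real.exp (-(t₀ / 2)) := Real.exp_le_exp.2 (by linarith)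
  have hH1 : 0 ≤ Real.exp (-(t / 2)) * hurwitzLerchQuarter t :=
    mul_nonneg (Real.exp_pos _).le (hurwitzLerchQuarter_nonneg t)
  have hH2 : Real.exp (-(t₀ / 2)) * hurwitzLerchQuarter t₀ ≤ CH := by
    calc Real.exp (-(t₀ / 2)) * hurwitzLerchQuarter t₀
        ≤ 1 * hurwitzLerchQuarter t₀ :=
          mul_le_mul_of_nonneg_right (by rw [Real.exp_le_one_iff]; linarith)
            (hurwitzLerchQuarter_nonneg t₀)
      _ ≤ CH := by rw [one_mul]; exact hurwitzLerchQuarter_le t₀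
  nlinarith [Real.exp_pos (t / 2)]

/-! ## 2. Dense sets hit late short windows -/

/-- **DENSE HITS (sharp window).**  If `A ⊆ ℕ` is `(C, θ)`-dense with `θ < 1`, then every `t ≥ 0` has
some `a ∈ A`, `a ≥ 1`, with `t ≤ log a ≤ t + (1 + |C|)·e^{-(1 - max θ 0)·t}`. -/
theorem denseHits {θ C : ℝ} (hθ : θ < 1) {A : Set ℕ}
    (hA : ∀ m : ℕ, 1 ≤ m → ∃ a ∈ A, m ≤ a ∧ (a : ℝ) ≤ m + C * (m : ℝ) ^ θ)
    {t : ℝ} (ht : 0 ≤ t) :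
    ∃ a ∈ A, 1 ≤ a ∧ t ≤ Real.log a ∧
      Real.log a ≤ t + (1 + |C|) * Real.exp (-((1 - max θ 0) * t)) := by
  set m : ℕ := ⌈Real.exp t⌉₊ with hm
  have hm1 : 1 ≤ m := Nat.one_le_iff_ne_zero.2 (Nat.pos_iff_ne_zero.1 (Nat.ceil_pos.2 (Real.exp_pos t)))
  have hmR : Real.exp t ≤ (m : ℝ) := Nat.le_ceil _
  have hmR' : (m : ℝ) < Real.exp t + 1 := Nat.ceil_lt_add_one (Real.exp_pos t).le
  have hm0 : (0 : ℝ) < m := (Real.exp_pos t).trans_le hmR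
  have hm1R : (1 : ℝ) ≤ m := by exact_mod_cast hm1
  obtain ⟨a, haA, hma, haub⟩ := hA m hm1
  have ha1 : 1 ≤ a := hm1.trans hma
  have ha0 : (0 : ℝ) < a := by exact_mod_cast Nat.lt_of_lt_of_le Nat.zero_lt_one ha1
  have hmaR : (m : ℝ) ≤ a := by exact_mod_cast hma
  refine ⟨a, haA, ha1, ?_, ?_⟩
  · -- `t = log e^t ≤ log m ≤ log a`
    calc t = Real.log (Real.exp t) := (Real.log_exp t).symm
      _ ≤ Real.log a := Real.log_le_log (Real.exp_pos t) (hmR.trans hmaR)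
  · -- `log a ≤ log m + |C| m^{θ⁺ - 1}` and `log m ≤ t + e^{-t}`
    set θ' : ℝ := max θ 0 with hθ'
    have hθ'0 : 0 ≤ θ' := le_max_right _ _
    have hθ'1 : θ' < 1 := max_lt hθ one_pos
    have hθθ' : θ ≤ θ' := le_max_left _ _
    -- density with exponent θ⁺ and |C|
    have hpow : C * (m : ℝ) ^ θ ≤ |C| * (m : ℝ) ^ θ' := by
      calc C * (m : ℝ) ^ θ ≤ |C| * (m : ℝ) ^ θ :=
            mul_le_mul_of_nonneg_right (le_abs_self C) (Real.rpow_nonneg hm0.le _)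
        _ ≤ |C| * (m : ℝ) ^ θ' :=
            mul_le_mul_of_nonneg_left (Real.rpow_le_rpow_of_exponent_le hm1R hθθ') (abs_nonneg C)
    have haub' : (a : ℝ) ≤ m * (1 + |C| * (m : ℝ) ^ (θ' - 1)) := by
      have : (m : ℝ) * (1 + |C| * (m : ℝ) ^ (θ' - 1)) = m + |C| * (m : ℝ) ^ θ' := by
        rw [Real.rpow_sub hm0, Real.rpow_one]
        field_simp
      rw [this]; linarith
    have hx0 : 0 < 1 + |C| * (m : ℝ) ^ (θ' - 1) := by positivity
    have hlog_a : Real.log a ≤ Real.log m + |C| * (m : ℝ) ^ (θ' - 1) := by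
      calc Real.log a ≤ Real.log (m * (1 + |C| * (m : ℝ) ^ (θ' - 1))) :=
            Real.log_le_log ha0 haub'
        _ = Real.log m + Real.log (1 + |C| * (m : ℝ) ^ (θ' - 1)) :=
            Real.log_mul hm0.ne' hx0.ne'
        _ ≤ Real.log m + |C| * (m : ℝ) ^ (θ' - 1) := by
            have := Real.log_le_sub_one_of_pos hx0; linarith
    have hlog_m : Real.log m ≤ t + Real.exp (-t) := by
      have h1 : Real.log m ≤ Real.log (Real.exp t * (1 + Real.exp (-t))) := by
        refine Real.log_le_log hm0 ?_
        have : Real.exp t * (1 + Real.exp (-t)) = Real.exp t + 1 := by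
          rw [mul_add, mul_one, ← Real.exp_add, add_neg_cancel, Real.exp_zero]
        rw [this]; exact hmR'.le
      have h2 : Real.log (Real.exp t * (1 + Real.exp (-t))) = t + Real.log (1 + Real.exp (-t)) := by
        rw [Real.log_mul (Real.exp_pos t).ne' (by positivity), Real.log_exp]
      have h3 : Real.log (1 + Real.exp (-t)) ≤ Real.exp (-t) := by
        have := Real.log_le_sub_one_of_pos (show (0:ℝ) < 1 + Real.exp (-t) by positivity); linarith
      linarith
    -- compare the two error terms with `e^{-(1-θ')t}`
    have hE1 : (m : ℝ) ^ (θ' - 1) ≤ Real.exp (-((1 - θ') * t)) := by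
      calc (m : ℝ) ^ (θ' - 1) ≤ (Real.exp t) ^ (θ' - 1) :=
            Real.rpow_le_rpow_of_nonpos (Real.exp_pos t) hmR (by linarith)
        _ = Real.exp (-((1 - θ') * t)) := by rw [← Real.exp_mul]; ring_nf
    have hE2 : Real.exp (-t) ≤ Real.exp (-((1 - θ') * t)) := Real.exp_le_exp.2 (by nlinarith)
    have hCabs : 0 ≤ |C| := abs_nonneg C
    calc Real.log a ≤ t + Real.exp (-t) + |C| * (m : ℝ) ^ (θ' - 1) := by linarith
      _ ≤ t + Real.exp (-((1 - θ') * t)) + |C| * Real.exp (-((1 - θ') * t)) := by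
          gcongr
      _ = t + (1 + |C|) * Real.exp (-((1 - θ') * t)) := by ring

/-- **Registered stub S3 `stub_denseHits`** of line `power-sparse-detect` (crux stmt-RiemannHypothesis-15757),
VERBATIM: a `(C, θ)`-dense set of positive integers, `θ < 1`, has an element whose logarithm lies in every
window `[t₀, t₀ + L]` with `L ≥ e^{-δ t₀}`, once `t₀ ≥ T` (here `δ = (1 - max θ 0)/2`,
`T = log(1+|C|)/δ`). RH-free, elementary. -/
theorem stub_denseHits :
    ∀ θ C : ℝ, θ < 1 → ∀ A : Set ℕ,
      (∀ m : ℕ, 1 ≤ m → ∃ a ∈ A, m ≤ a ∧ (a : ℝ) ≤ m + C * (m : ℝ) ^ θ) →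
      ∃ δ : ℝ, 0 < δ ∧ δ ≤ 1 ∧ ∃ T : ℝ, 0 ≤ T ∧ ∀ t₀ L : ℝ, T ≤ t₀ → Real.exp (-(δ * t₀)) ≤ L →
        ∃ a ∈ A, 1 ≤ a ∧ t₀ ≤ Real.log a ∧ Real.log a ≤ t₀ + L := by
  intro θ C hθ A hA
  set θ' : ℝ := max θ 0 with hθ'
  have hθ'1 : θ' < 1 := max_lt hθ one_pos
  set δ : ℝ := (1 - θ') / 2 with hδ
  have hδ0 : 0 < δ := by simp only [hδ]; linarith
  have hδ1 : δ ≤ 1 := by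
    have : 0 ≤ θ' := le_max_right _ _
    simp only [hδ]; linarith
  have hC1 : 1 ≤ 1 + |C| := by linarith [abs_nonneg C]
  set T : ℝ := Real.log (1 + |C|) / δ with hT
  have hT0 : 0 ≤ T := div_nonneg (Real.log_nonneg hC1) hδ0.le
  refine ⟨δ, hδ0, hδ1, T, hT0, fun t₀ L ht₀ hL ↦ ?_⟩
  have ht₀0 : 0 ≤ t₀ := hT0.trans ht₀
  obtain ⟨a, haA, ha1, hlo, hhi⟩ := denseHits hθ hA ht₀0
  refine ⟨a, haA, ha1, hlo, hhi.trans ?_⟩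
  -- `(1+|C|) e^{-(1-θ')t₀} = (1+|C|) e^{-δt₀} · e^{-δt₀} ≤ e^{-δ t₀} ≤ L`
  have hkey : (1 + |C|) * Real.exp (-(δ * t₀)) ≤ 1 := by
    have h1 : Real.log (1 + |C|) ≤ δ * t₀ := by
      have : Real.log (1 + |C|) = δ * T := by simp only [hT]; field_simp
      rw [this]; exact mul_le_mul_of_nonneg_left ht₀ hδ0.le
    have h2 : 1 + |C| ≤ Real.exp (δ * t₀) := by
      calc 1 + |C| = Real.exp (Real.log (1 + |C|)) := (Real.exp_log (by linarith)).symm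
        _ ≤ Real.exp (δ * t₀) := Real.exp_le_exp.2 h1
    have h3 : Real.exp (δ * t₀) * Real.exp (-(δ * t₀)) = 1 := by
      rw [← Real.exp_add, add_neg_cancel, Real.exp_zero]
    nlinarith [Real.exp_pos (-(δ * t₀)), Real.exp_pos (δ * t₀)]
  have hsplit : Real.exp (-((1 - θ') * t₀)) = Real.exp (-(δ * t₀)) * Real.exp (-(δ * t₀)) := by
    rw [← Real.exp_add]; congr 1; simp only [hδ]; ring
  calc t₀ + (1 + |C|) * Real.exp (-((1 - max θ 0) * t₀))
      = t₀ + (1 + |C|) * Real.exp (-(δ * t₀)) * Real.exp (-(δ * t₀)) := by rw [← hθ', hsplit]; ring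
    _ ≤ t₀ + 1 * Real.exp (-(δ * t₀)) := by
        gcongr
    _ ≤ t₀ + L := by rw [one_mul]; linarith

/-! ## 3. Sparse positivity ⟹ graded floor ⟹ (quasi-)RH -/

/-- **GRADED FLOOR FROM SPARSE POSITIVITY.**  If `Ψ(log a) ≥ 0` for all `a` in a `(C, θ)`-dense set
`A ⊆ ℕ` (`θ < 1`), then `Ψ(t) ≥ −K e^{max(θ − 1/2, 0)·t}` for all `t ≥ 0`. -/
theorem floor_of_sparsePos {θ C : ℝ} (hθ : θ < 1) {A : Set ℕ}
    (hA : ∀ m : ℕ, 1 ≤ m → ∃ a ∈ A, m ≤ a ∧ (a : ℝ) ≤ m + C * (m : ℝ) ^ θ)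
    (hpos : ∀ m ∈ A, 0 ≤ zetaScrew (Real.log m)) :
    ∃ K : ℝ, 0 ≤ K ∧ ∀ t : ℝ, 0 ≤ t → -K * Real.exp (max (θ - 1 / 2) 0 * t) ≤ zetaScrew t := by
  set θ' : ℝ := max θ 0 with hθ'
  set γ : ℝ := max (θ - 1 / 2) 0 with hγ
  set W : ℝ := 1 + |C| with hW
  set CH : ℝ := ∑' k : ℕ, 1 / ((k : ℝ) + 1 / 4) ^ 2 with hCH
  have hW1 : 1 ≤ W := by simp only [hW]; linarith [abs_nonneg C]
  have hCH0 : 0 ≤ CH := tsum_nonneg fun k ↦ by positivity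
  set K : ℝ := 2 * Real.exp (W / 2) * W + CH / 4 with hK
  have hK0 : 0 ≤ K := by positivity
  refine ⟨K, hK0, fun t ht ↦ ?_⟩
  obtain ⟨a, haA, ha1, hlo, hhi⟩ := denseHits hθ hA ht
  have ha0 : (0 : ℝ) < a := by exact_mod_cast Nat.lt_of_lt_of_le Nat.zero_lt_one ha1
  -- the window length `w = log a - t ≤ W e^{-(1-θ')t} ≤ W`
  have hE0 : Real.exp (-((1 - θ') * t)) ≤ 1 := by
    rw [Real.exp_le_one_iff]
    have : θ' < 1 := max_lt hθ one_pos
    nlinarith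
  have hw : Real.log a - t ≤ W * Real.exp (-((1 - θ') * t)) := by rw [hθ']; linarith
  have hwW : Real.log a - t ≤ W := hw.trans (by nlinarith)
  -- rise over the window
  have hrise := rise_le ht hlo
  have hposa : 0 ≤ zetaScrew (Real.log a) := hpos a haA
  have hexp_a : Real.exp (Real.log a / 2) ≤ Real.exp (W / 2) * Real.exp (t / 2) := by
    rw [← Real.exp_add]; exact Real.exp_le_exp.2 (by linarith)
  -- `e^{t/2} e^{-(1-θ')t} ≤ e^{γ t}` and `1 ≤ e^{γ t}`
  have hγ0 : 0 ≤ γ := le_max_right _ _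
  have hexp1 : Real.exp (t / 2) * Real.exp (-((1 - θ') * t)) ≤ Real.exp (γ * t) := by
    rw [← Real.exp_add]
    refine Real.exp_le_exp.2 ?_
    have h1 : θ' - 1 / 2 ≤ γ := by
      simp only [hθ', hγ]
      rcases le_or_gt θ 0 with h | h
      · rw [max_eq_right h]; linarith [le_max_right (θ - 1 / 2) 0]
      · rw [max_eq_left h.le]; exact le_max_left _ _
    nlinarith
  have hexp2 : 1 ≤ Real.exp (γ * t) := Real.one_le_exp (by positivity)
  -- assemble: Ψ t ≥ Ψ(log a) - rise ≥ -(2 e^{(log a)/2} w + CH/4) ≥ -K e^{γ t}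
  have h1 : 2 * Real.exp (Real.log a / 2) * (Real.log a - t) ≤
      2 * (Real.exp (W / 2) * Real.exp (t / 2)) * (W * Real.exp (-((1 - θ') * t))) :=
    mul_le_mul (mul_le_mul_of_nonneg_left hexp_a (by norm_num)) hw (by linarith)
      (by positivity)
  have h2 : 2 * (Real.exp (W / 2) * Real.exp (t / 2)) * (W * Real.exp (-((1 - θ') * t)))
      = 2 * Real.exp (W / 2) * W * (Real.exp (t / 2) * Real.exp (-((1 - θ') * t))) := by ring
  have h3 : 2 * Real.exp (W / 2) * W * (Real.exp (t / 2) * Real.exp (-((1 - θ') * t)))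
      ≤ 2 * Real.exp (W / 2) * W * Real.exp (γ * t) :=
    mul_le_mul_of_nonneg_left hexp1 (by positivity)
  have h4 : CH / 4 ≤ CH / 4 * Real.exp (γ * t) := by
    calc CH / 4 = CH / 4 * 1 := (mul_one _).symm
      _ ≤ CH / 4 * Real.exp (γ * t) := mul_le_mul_of_nonneg_left hexp2 (by positivity)
  have hKexp : K * Real.exp (γ * t) = 2 * Real.exp (W / 2) * W * Real.exp (γ * t)
      + CH / 4 * Real.exp (γ * t) := by simp only [hK]; ring
  linarith

/-- **GRADED SPARSE DETECTION.**  Positivity of `Ψ` at the logarithms of a `(C, θ)`-dense set of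
integers (`θ < 1`) implies `QuasiRiemannHypothesis (1/2 + max (θ − 1/2) 0)`. -/
theorem quasiRH_of_sparsePos {θ C : ℝ} (hθ : θ < 1) {A : Set ℕ}
    (hA : ∀ m : ℕ, 1 ≤ m → ∃ a ∈ A, m ≤ a ∧ (a : ℝ) ≤ m + C * (m : ℝ) ^ θ)
    (hpos : ∀ m ∈ A, 0 ≤ zetaScrew (Real.log m)) :
    QuasiRiemannHypothesis (1 / 2 + max (θ - 1 / 2) 0) := by
  obtain ⟨K, _, hK⟩ := floor_of_sparsePos hθ hA hpos
  exact (quasiRH_iff_exp_floor (le_max_right _ _)).2 ⟨K, hK⟩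

/-- **SPARSE DETECTION BELOW THE SQUARE-ROOT SCALE ⟹ RH.**  For `θ ≤ 1/2`: if `Ψ(log a) ≥ 0` for all
`a` in some `(C, θ)`-dense `A ⊆ ℕ`, then RH. (`A = ℕ≥1`, `C = 0` is the tree's `DiscreteLandau`.) -/
theorem rh_of_sparsePos {θ C : ℝ} (hθ : θ ≤ 1 / 2) {A : Set ℕ}
    (hA : ∀ m : ℕ, 1 ≤ m → ∃ a ∈ A, m ≤ a ∧ (a : ℝ) ≤ m + C * (m : ℝ) ^ θ)
    (hpos : ∀ m ∈ A, 0 ≤ zetaScrew (Real.log m)) :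
    Summit.RiemannHypothesis := by
  obtain ⟨K, hK0, hK⟩ := floor_of_sparsePos (hθ.trans_lt (by norm_num)) hA hpos
  have hγ : max (θ - 1 / 2) 0 = 0 := max_eq_right (by linarith)
  refine rh_iff_subexp_floor.2 fun ε hε ↦ ⟨K, fun t ht ↦ ?_⟩
  have h1 := hK t ht
  rw [hγ, zero_mul, Real.exp_zero, mul_one] at h1
  have h2 : 1 ≤ Real.exp (ε * t) := Real.one_le_exp (by positivity)
  nlinarith

/-- **SPARSE DETECTION ABOVE THE SQUARE-ROOT SCALE ⟹ quasi-RH(θ).**  For `1/2 ≤ θ < 1`: positivity of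
`Ψ∘log` on a `(C, θ)`-dense set of integers implies `ζ(s) ≠ 0` for `Re s > θ`. -/
theorem quasiRH_of_sparsePos_of_half_le {θ C : ℝ} (hθ : 1 / 2 ≤ θ) (hθ1 : θ < 1) {A : Set ℕ}
    (hA : ∀ m : ℕ, 1 ≤ m → ∃ a ∈ A, m ≤ a ∧ (a : ℝ) ≤ m + C * (m : ℝ) ^ θ)
    (hpos : ∀ m ∈ A, 0 ≤ zetaScrew (Real.log m)) :
    QuasiRiemannHypothesis θ := by
  have h := quasiRH_of_sparsePos hθ1 hA hpos
  rwa [max_eq_left (by linarith), add_sub_cancel] at h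

/-- The statement `Theses.SparseScrew.SqrtSparseDetect` (`∀ C, Rung C (1/2)`) of the line file
Cruxes/ScrewPolyFloor/Lines/PowerSparseDetect.lean, spelled out, as a THEOREM (RH-free). -/
theorem sqrtSparseDetect :
    ∀ C : ℝ, ∀ A : Set ℕ,
      (∀ m : ℕ, 1 ≤ m → ∃ a ∈ A, m ≤ a ∧ (a : ℝ) ≤ m + C * (m : ℝ) ^ (1 / 2 : ℝ)) →
      (∀ m ∈ A, 0 ≤ Literature.NumberTheory.LFunctions.zetaScrew (Real.log m)) →
        Summit.RiemannHypothesis :=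
  fun _ _ hA hpos ↦ rh_of_sparsePos le_rfl hA hpos

/-- `Rung C θ` of the line file for every `θ ≤ 1/2` and every `C`, spelled out (RH-free theorem). -/
theorem rung_of_le_half :
    ∀ θ : ℝ, θ ≤ 1 / 2 → ∀ C : ℝ, ∀ A : Set ℕ,
      (∀ m : ℕ, 1 ≤ m → ∃ a ∈ A, m ≤ a ∧ (a : ℝ) ≤ m + C * (m : ℝ) ^ θ) →
      (∀ m ∈ A, 0 ≤ Literature.NumberTheory.LFunctions.zetaScrew (Real.log m)) →
        Summit.RiemannHypothesis :=
  fun _ hθ _ _ hA hpos ↦ rh_of_sparsePos hθ hA hpos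


/-! ## 4. A concrete sparse criterion: the perfect squares -/

/-- The perfect squares are `(3, 1/2)`-dense: every `m ≥ 1` has a square in `[m, m + 3√m]`. -/
theorem squares_dense : ∀ m : ℕ, 1 ≤ m →
    ∃ a ∈ {n : ℕ | ∃ k : ℕ, n = k ^ 2}, m ≤ a ∧ (a : ℝ) ≤ m + 3 * (m : ℝ) ^ (1 / 2 : ℝ) := by
  intro m hm
  have hm0 : (0 : ℝ) ≤ m := by positivity
  have hm1 : (1 : ℝ) ≤ m := by exact_mod_cast hm
  set s : ℝ := Real.sqrt m with hs
  have hs1 : 1 ≤ s := by rw [hs, Real.one_le_sqrt]; exact hm1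
  have hss : s * s = m := Real.mul_self_sqrt hm0
  set k : ℕ := ⌈s⌉₊ with hk
  have hks : s ≤ (k : ℝ) := Nat.le_ceil s
  have hks' : (k : ℝ) < s + 1 := Nat.ceil_lt_add_one (by linarith)
  have hk0 : (0 : ℝ) ≤ k := by positivity
  refine ⟨k ^ 2, ⟨k, rfl⟩, ?_, ?_⟩
  · have h : (m : ℝ) ≤ (k : ℝ) ^ 2 := by nlinarith
    exact_mod_cast h
  · rw [← Real.sqrt_eq_rpow, ← hs]
    push_cast
    nlinarith

/-- **RH ⟺ `Ψ ≥ 0` AT THE PERFECT SQUARES**, i.e. at `t = 2 log k`, `k ≥ 1`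
(⟸: `sqrtSparseDetect` with `A` = squares, gaps `≤ 3√m`; ⟹: Suzuki2023 Thm 1.7,
`ZetaScrewThm17.zetaScrew_nonneg_of_RH`). -/
theorem rh_iff_nonneg_at_squares :
    Summit.RiemannHypothesis ↔ ∀ k : ℕ, 1 ≤ k → 0 ≤ zetaScrew (2 * Real.log k) := by
  constructor
  · intro hRH k _
    exact ZetaScrewThm17.zetaScrew_nonneg_of_RH hRH _
  · intro h
    refine sqrtSparseDetect 3 {n : ℕ | ∃ k : ℕ, n = k ^ 2} squares_dense ?_
    rintro m ⟨k, rfl⟩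
    rcases Nat.eq_zero_or_pos k with hk | hk
    · subst hk; simp [zetaScrew_zero]
    · have : Real.log ((k ^ 2 : ℕ) : ℝ) = 2 * Real.log k := by push_cast; rw [Real.log_pow]; norm_num
      rw [this]; exact h k hk

end Summit.RiemannHypothesis.RiemannHypothesis.Theorems.Splittings.ScrewSparseDetect
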